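import Mathlib
import HarnessLib
import Summits.ValiantsHypothesis.ValiantsHypothesis.Theses.MonotoneRestoration
import Literature.Computability.AlgebraicComplexity.ArithCircuit
import Literature.Computability.AlgebraicComplexity.ArithCircuitProofs
import Literature.Computability.AlgebraicComplexity.MonotoneStructure
import Literature.Computability.AlgebraicComplexity.PermanentIrreducible
import Literature.ModelTheory.FiniteModelTheory.CkEquiv
import Summits.ValiantsHypothesis.ValiantsHypothesis.Theorems.MonotoneRestorationMonotoneRestorationQPCosetCount
import Summits.ValiantsHypothesis.ValiantsHypothesis.Theorems.MonotoneRestorationMonotoneRestorationQPSymmetricLB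
import Summits.ValiantsHypothesis.ValiantsHypothesis.Theorems.MonotoneRestorationMonotoneRestorationQPSupportSymmetrisation
import Summits.ValiantsHypothesis.ValiantsHypothesis.Theorems.MonotoneRestorationMonotoneRestorationQPSparseRegime
import Summits.ValiantsHypothesis.ValiantsHypothesis.Theorems.MonotoneRestorationMonotoneRestorationQPBeta
import Literature.Computability.AlgebraicComplexity.SymmetricArithCircuit
import Literature.Computability.AlgebraicComplexity.DawarWilsenach2025Proofs
import Literature.GroupTheory.PermutationGroups.SmallIndexSubgroups
import Summits.ValiantsHypothesis.ValiantsHypothesis.Theorems.MonotoneRestorationQP.Negative.LoadBearing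
import Summits.ValiantsHypothesis.ValiantsHypothesis.Theorems.MonotoneRestorationMonotoneRestorationQPPermSupportCount

/-! TTRL-lite variant V19134 of stmt-ValiantsHypothesis-15886 -/

namespace Summit.ValiantsHypothesis.ValiantsHypothesis.Theorems

open Summit.ValiantsHypothesis.ValiantsHypothesis.Theses.MonotoneRestoration
open Literature.Computability.AlgebraicComplexity

/-- TTRL-lite variant V19134 of `stub_esymmRowSums_structure` (stmt-ValiantsHypothesis-15886):
the symmetry of the elementary symmetric polynomial `esymm (Fin n) NNReal k` absorbs any
permutation `σ` of the substitution `g`, i.e. `bind₁ (g ∘ σ) e_k = bind₁ g e_k`.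
Proof: `bind₁ (g ∘ σ) e_k = bind₁ g (rename σ e_k)` (`MvPolynomial.bind₁_rename`) and
`rename σ e_k = e_k` (`MvPolynomial.rename_esymm`). -/
theorem stub_esymmRowSums_structure_var19134 :
    ∀ (n k : ℕ) (σ : Equiv.Perm (Fin n)) (g : Fin n → MvPolynomial (Fin n × Fin n) NNReal),
      MvPolynomial.bind₁ (fun i : Fin n => g (σ i)) (MvPolynomial.esymm (Fin n) NNReal k) =
        MvPolynomial.bind₁ g (MvPolynomial.esymm (Fin n) NNReal k) := by
  intro n k σ g
  have h : (fun i : Fin n => g (σ i)) = g ∘ (σ : Fin n → Fin n) := rfl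
  rw [h, ← MvPolynomial.bind₁_rename, MvPolynomial.rename_esymm]

end Summit.ValiantsHypothesis.ValiantsHypothesis.Theorems
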